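import Summits.HodgeConjecture.HodgeCM.Model.ArchKTypeOfFrameMatch_1

/-! PORT of `HodgeCM/Model/ArchKTypeOfFrameMatch.lean` (HodgeCMPerL run 82) — part 2: continuation of `Summits.HodgeConjecture.HodgeCM.Model.ArchKTypeOfFrameMatch_1` (split at a top-level declaration boundary by port_pkg.py; scope re-opened below; declarations unchanged). -/

-- port_pkg: scope re-opened for this part (file-level context, then the namespace/section stack open at the cut)
set_option autoImplicit false
noncomputable section
open NumberField NumberField.InfinitePlace NumberField.mixedEmbedding IsDedekindDomain
open scoped Matrix Classical
open Literature.Geometry.ComplexHyperbolic.BallModel (U21 mat)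
open Literature.NumberTheory.Automorphic
open Literature.NumberTheory.Weil1964
open Literature.RepresentationTheory.KonnoKonno2007 Literature.RepresentationTheory.KonnoKonno2007.RealDualPair
open Literature.NumberTheory.GelbartRogawski1991 Literature.NumberTheory.GelbartRogawski1991.UnitaryDualPair
namespace HodgeCM.Model
variable {L : CMField} {ι₁ : L →+* ℂ} (V : HermSpace3 L ι₁)
/-- components at (propositionally) equal complex places have the same matrix. -/
theorem coe_archAt_eq_of_eq {w w' : {w : InfinitePlace (L : Type) // w.IsComplex}} (h : w = w')
    (hw : IsCMField.complexConj (L : Type) • w.1 = w.1) (hw' : IsCMField.complexConj (L : Type) • w'.1 = w'.1)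
    (x : UnitaryGroup.arch (↥(maximalRealSubfield L)) L (IsCMField.complexConj L) 3 (Matrix.diagonal (frameD V))) :
    ((UnitaryGroup.archAt (↥(maximalRealSubfield L)) L (IsCMField.complexConj L) 3 (Matrix.diagonal (frameD V)) w hw
        (IsCMField.complexConj_ne_one (L : Type)) x : UnitaryGroup.archLocal (L : Type) 3 (Matrix.diagonal (frameD V)) w) :
          GL (Fin 3) ℂ) =
      ((UnitaryGroup.archAt (↥(maximalRealSubfield L)) L (IsCMField.complexConj L) 3 (Matrix.diagonal (frameD V)) w' hw'
        (IsCMField.complexConj_ne_one (L : Type)) x : UnitaryGroup.archLocal (L : Type) 3 (Matrix.diagonal (frameD V)) w') :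
          GL (Fin 3) ℂ) := by
  subst h
  rfl

section Main

variable {M : ℕ} (dW : Fin M → (L : Type)) (hdW : ∀ i, IsCMField.complexConj L (dW i) = dW i) (hdW0 : ∀ i, dW i ≠ 0)

/-- **FRAME MATCHING (J-x₀)⇄(J-arch), `V`-factor.**  Binder-2's block section on the twisted ball frame, un-relabelled by the
canonical `eP = blockPosEquiv V`, `eQ = blockNegEquiv V`, IS the `ι₁`-section of record in the rational CM frame:
`(cmBlockSection eP eQ (u21FrameEquiv (twistU21 u), 1)).1 = archSectionFrameOf V u`. -/
theorem cmBlockSection_twist_fst (u : U21) :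
    (HypCensus.cmBlockSection (L : Type) (frameD V) (frameD_real V) (frameD_ne V) dW hdW hdW0 ι₁ (blockPosEquiv V)
        (blockNegEquiv V) (u21FrameEquiv (twistU21 L ι₁ u), 1)).1 = archSectionFrameOf V u := by
  apply (UnitaryGroup.archPiEquiv (↥(maximalRealSubfield L)) L (IsCMField.complexConj L) 3 (Matrix.diagonal (frameD V))
    (IsCMField.complexConj_ne_one (L : Type)) (NumberField.complexConj_smul_infinitePlace (L : Type))).injective
  funext w
  simp only [UnitaryGroup.archPiEquiv_apply]
  by_cases hw : w = cmPlaceOver (L : Type) (HypCensus.cmPlace (L : Type) ι₁)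
  · subst hw
    apply Subtype.ext
    rw [HypCensus.archAt_cmBlockSection_fst_self, coe_cmPairFrameEquiv_symm_twist_fst,
      coe_archAt_eq_of_eq V (cmPlaceOver_cmPlace_eq (L := L) (ι₁ := ι₁)) _
        (NumberField.complexConj_smul_infinitePlace (L : Type) _) (archSectionFrameOf V u),
      coe_archAt_archSectionFrameOf_cmPlace']
  · rw [HypCensus.archAt_cmBlockSection_fst_of_ne _ _ _ _ _ _ _ _ _ _ hw, archAt_archSectionFrameOf_of_ne]
    rwa [← cmPlaceOver_cmPlace_eq]

/-- **FRAME MATCHING, `W`-factor**: trivial. -/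
theorem cmBlockSection_twist_snd (u : U21) :
    (HypCensus.cmBlockSection (L : Type) (frameD V) (frameD_real V) (frameD_ne V) dW hdW hdW0 ι₁ (blockPosEquiv V)
        (blockNegEquiv V) (u21FrameEquiv (twistU21 L ι₁ u), 1)).2 = 1 :=
  HypCensus.cmBlockSection_snd_eq_one (L : Type) (frameD V) (frameD_real V) (frameD_ne V) dW hdW hdW0 ι₁ (blockPosEquiv V)
    (blockNegEquiv V) _

/-- **FRAME MATCHING, pair form**: `cmBlockSection eP eQ (u21FrameEquiv (twistU21 u), 1) = (archSectionFrameOf V u, 1)`. -/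
theorem cmBlockSection_twist (u : U21) :
    HypCensus.cmBlockSection (L : Type) (frameD V) (frameD_real V) (frameD_ne V) dW hdW hdW0 ι₁ (blockPosEquiv V)
        (blockNegEquiv V) (u21FrameEquiv (twistU21 L ι₁ u), 1) = (archSectionFrameOf V u, 1) :=
  Prod.ext (cmBlockSection_twist_fst V dW hdW hdW0 u) (cmBlockSection_twist_snd V dW hdW hdW0 u)

/-- `twistU21` is an involution. -/
@[simp] theorem twistU21_twistU21 (u : U21) : twistU21 L ι₁ (twistU21 L ι₁ u) = u := by
  apply Subtype.ext
  apply Units.ext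
  ext i j
  exact UnitaryGroup.embTwist_embTwist (L : Type) ι₁ _

/-- **… on the UNTWISTED ball frame**: `cmBlockSection eP eQ (u21FrameEquiv u, 1) = (archSectionFrameOf V (twistU21 u), 1)`. -/
theorem cmBlockSection_u21FrameEquiv (u : U21) :
    HypCensus.cmBlockSection (L : Type) (frameD V) (frameD_real V) (frameD_ne V) dW hdW hdW0 ι₁ (blockPosEquiv V)
        (blockNegEquiv V) (u21FrameEquiv u, 1) = (archSectionFrameOf V (twistU21 L ι₁ u), 1) := by
  rw [← cmBlockSection_twist V dW hdW hdW0 (twistU21 L ι₁ u), twistU21_twistU21]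

end Main

end HodgeCM.Model

-- port_pkg: scope closed for this part
end
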